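import Literature.AlgebraicGeometry.Dimension.SmoothRelativeDimensionLocus
import Literature.AlgebraicGeometry.Deformation.MorphismLiftsSquareZeroTorsorDimension
import Literature.AlgebraicGeometry.AbelianSchemes.AbelianSchemeOverBase
import HarnessLib

/-!
# A standard-smooth chart of relative dimension `g` at a point whose FIBRE has dimension `g` (smooth morphisms over an
# affine base; the chart of the (Mc) N3′ Kodaira–Spencer count, cell hodgecm-mathlib J11 §2)

Topic `Literature/AlgebraicGeometry/Dimension`; namespace `Literature.AlgebraicGeometry.Dimension` (+ one corollary in
`Literature.AlgebraicGeometry.AbelianSchemes.AbelianSchemeOver`).  THEOREMS ONLY (no definition, no instance, no notation, no `sorry`).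

[GortzWedhorn2020] Def. 6.14 ∕ Prop. 6.15 (1): a smooth morphism `f : X → S` is, near each point `x`, standard smooth of the relative
dimension `dim_x f⁻¹(f x)` read on the fibre, and the locus of a given relative dimension is open (and closed).  Hence, over an AFFINE base
`S` (scalar ring `R₀ = Γ(S, 𝒪)`): if the base change of `f` along SOME `s : T → S` whose image contains `f x` is smooth of relative
dimension `g` — e.g. the fibre `X ×_S Spec κ → Spec κ` — then `x` has an AFFINE open neighbourhood `V` whose full scalar map
`R₀ → Γ(X, V)` is STANDARD SMOOTH OF RELATIVE DIMENSION `g` (Mathlib `RingHom.IsStandardSmoothOfRelativeDimension`).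

* `exists_isStandardSmoothOfRelativeDimension_chart_of_pullback_snd` — the statement above: `x` lies in the largest open `U_g` of
  relative dimension `g` (★ `SmoothRelativeDimensionLocus.mem_of_smoothOfRelativeDimension_pullback_snd`, the fibre criterion), `U_g → Spec R₀`
  has standard-smooth charts of relative dimension `g` (★ `Deformation/MorphismLiftsSquareZeroTorsorDimension.exists_isStandardSmoothOfRelativeDimension_chart`),
  and a chart of `U_g` is a chart of `X` (image along the open immersion, Mathlib `Scheme.Hom.appIso`; the property respects isomorphisms);
* `AbelianSchemeOver.exists_isStandardSmoothOfRelativeDimension_chart_of_isOfRelDim_baseChange` — for an abelian scheme `A → S` over an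
  affine `S` and `hg : (A.baseChange s).IsOfRelDim g`: the chart at every point of `A` over the image of `s` — the `(V, hV, hVg)` socket of the
  S-e closer (F0P1c-p01 (g0) SOCKETS §1), with THE SAME `g` as the fibre (★ J11 §1 `AbelianSchemeLocalRelDim`).

Cell hodgecm-mathlib (D-0151 ∕ FLOOR 0), P1 (Mc) N3′ J11 §2 (lead B-p02 (g17)); PROOF lane, count-neutral generic capital.
HC_CM is proved only modulo the 7 printed citations until rung 0 closes; nothing here is about HC.

## References
* [GortzWedhorn2020] U. Görtz, T. Wedhorn, *Algebraic Geometry I*, 2nd ed. (2020): Def. 6.14 and Prop. 6.15 (1), Lemma 6.26; Remark 16.54 (p. 539).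
* [StacksProject] The Stacks Project, Tag 00T7 (standard smooth algebras), Tag 01V4 (smooth morphisms).
-/

noncomputable section

universe u

open CategoryTheory CategoryTheory.Limits AlgebraicGeometry TopologicalSpace

namespace Literature.AlgebraicGeometry.Dimension

/-- **A standard-smooth chart of relative dimension `g` at a point over which some base change is smooth of relative dimension `g`.**
Let `S` be affine, `f : X → S` smooth, `s : T → S` with `X ×_S T → T` smooth of relative dimension `g`, and `x ∈ X` with
`f x ∈ im s`.  Then there is an affine open `V ∋ x` whose full scalar map `Γ(S, 𝒪) ≅ Γ(Spec Γ(S,𝒪), ⊤) → Γ(X, V)` (along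
`f ≫ S.isoSpec`) is standard smooth of relative dimension `g`. [cite: GortzWedhorn2020, Def. 6.14 and Prop. 6.15 (1), Lemma 6.26]
[cite: StacksProject, Tag 00T7] -/
theorem exists_isStandardSmoothOfRelativeDimension_chart_of_pullback_snd {X S T : Scheme.{u}} [IsAffine S]
    (f : X ⟶ S) [Smooth f] (g : ℕ) (s : T ⟶ S) [SmoothOfRelativeDimension g (pullback.snd f s)]
    (x : X) (hx : f x ∈ Set.range s) :
    ∃ V : X.Opens, IsAffineOpen V ∧ x ∈ V ∧
      ((Scheme.ΓSpecIso (.of Γ(S, ⊤))).inv ≫ (f ≫ S.isoSpec.hom).appLE ⊤ V le_top).hom.IsStandardSmoothOfRelativeDimension g := by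
  classical
  -- `x` lies in the largest open `U` of relative dimension `g` (fibre criterion)
  obtain ⟨U, hU, hmax⟩ := exists_opens_smoothOfRelativeDimension_maximal f g
  have hxU : x ∈ U := mem_of_smoothOfRelativeDimension_pullback_snd f hmax s hx
  -- a standard-smooth chart of `U → Spec Γ(S, 𝒪)` at `x`
  haveI : SmoothOfRelativeDimension g (U.ι ≫ f ≫ S.isoSpec.hom) := by
    rw [← Category.assoc]
    exact (MorphismProperty.cancel_right_of_respectsIso (@SmoothOfRelativeDimension g) _ _).mpr hU
  obtain ⟨V', hV', hxV', hP'⟩ :=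
    Deformation.exists_isStandardSmoothOfRelativeDimension_chart (R₀ := Γ(S, ⊤)) (U.ι ≫ f ≫ S.isoSpec.hom) g ⟨x, hxU⟩
  -- push it out along the open immersion `U ↪ X`
  refine ⟨U.ι ''ᵁ V', hV'.image_of_isOpenImmersion U.ι, ⟨⟨x, hxU⟩, hxV', rfl⟩, ?_⟩
  have hcomp : (Scheme.ΓSpecIso (.of Γ(S, ⊤))).inv ≫ (U.ι ≫ f ≫ S.isoSpec.hom).appLE ⊤ V' le_top =
      ((Scheme.ΓSpecIso (.of Γ(S, ⊤))).inv ≫ (f ≫ S.isoSpec.hom).appLE ⊤ (U.ι ''ᵁ V') le_top) ≫ (U.ι.appIso V').hom := by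
    rw [Category.assoc, Scheme.Hom.appIso_hom', Scheme.Hom.appLE_comp_appLE]
  rw [hcomp, CommRingCat.hom_comp] at hP'
  exact ((RingHom.isStandardSmoothOfRelativeDimension_respectsIso (n := g)).cancel_right_isIso _ _).mp hP'

/-- The same with the hypothesis phrased on a field-valued FIBRE `X ×_S Spec K → Spec K` through `f x`.
[cite: GortzWedhorn2020, Def. 6.14 and Prop. 6.15 (1), Lemma 6.26] -/
theorem exists_isStandardSmoothOfRelativeDimension_chart_of_fibre {X S : Scheme.{u}} [IsAffine S]
    (f : X ⟶ S) [Smooth f] (g : ℕ) {K : Type u} [Field K] (s : Spec (.of K) ⟶ S)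
    [SmoothOfRelativeDimension g (pullback.snd f s)] (x : X) (hx : f x = s (IsLocalRing.closedPoint K)) :
    ∃ V : X.Opens, IsAffineOpen V ∧ x ∈ V ∧
      ((Scheme.ΓSpecIso (.of Γ(S, ⊤))).inv ≫ (f ≫ S.isoSpec.hom).appLE ⊤ V le_top).hom.IsStandardSmoothOfRelativeDimension g :=
  exists_isStandardSmoothOfRelativeDimension_chart_of_pullback_snd f g s x ⟨_, hx.symm⟩

end Literature.AlgebraicGeometry.Dimension

namespace Literature.AlgebraicGeometry.AbelianSchemes

namespace AbelianSchemeOver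

/-- **The chart socket of the S-e closer.**  For an abelian scheme `A → S` over an AFFINE base, a morphism `s : T → S` with
`(A.baseChange s).IsOfRelDim g` (e.g. the `κ`-fibre, with the `g` of ★ `AbelianSchemeLocalRelDim`), and a point `x` of `A` over the
image of `s`, there is an affine open `V ∋ x` whose full scalar map `Γ(S, 𝒪) → Γ(A, V)` along `A.X.hom ≫ S.isoSpec` is standard
smooth of relative dimension `g` — the input `(hV, pX := A.X.hom ≫ S.isoSpec.hom, g, hVg)` of the infinitesimal-point panels
(★ `Deformation/MorphismLiftsSquareZeroTorsorDimension`). [cite: GortzWedhorn2020, Def. 6.14 and Prop. 6.15 (1), Lemma 6.26]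
[cite: GortzWedhorn2020, Remark 16.54 (p. 539)] -/
theorem exists_isStandardSmoothOfRelativeDimension_chart_of_isOfRelDim_baseChange {S : Scheme.{u}} [IsAffine S]
    (A : AbelianSchemeOver S) {T : Scheme.{u}} (s : T ⟶ S) {g : ℕ} (hg : (A.baseChange s).IsOfRelDim g)
    (x : A.X.left) (hx : A.X.hom x ∈ Set.range s) :
    ∃ V : A.X.left.Opens, IsAffineOpen V ∧ x ∈ V ∧
      ((Scheme.ΓSpecIso (.of Γ(S, ⊤))).inv ≫ (A.X.hom ≫ S.isoSpec.hom).appLE ⊤ V le_top).hom.IsStandardSmoothOfRelativeDimension g :=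
  haveI := A.isSmooth
  haveI : SmoothOfRelativeDimension g (pullback.snd A.X.hom s) := hg
  Dimension.exists_isStandardSmoothOfRelativeDimension_chart_of_pullback_snd A.X.hom g s x hx

end AbelianSchemeOver

end Literature.AlgebraicGeometry.AbelianSchemes

end
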